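import Literature.NumberTheory.GaloisRepresentations.ContinuousShapiroLiftCores
import Literature.NumberTheory.GaloisRepresentations.ContinuousShapiroLiftPairing
import HarnessLib

/-!
# The projection formula AT THE TOP: `cor(a) ∪ b = Sh_N(a) ∪_Σ Sh_N(b|_N)` — the honest cup product of a
# corestricted class against a class of the whole group, computed in the Shapiro model

Generic continuous group cohomology (no number theory); namespace `Literature.NumberTheory.GaloisRepresentations`.
THEOREMS ONLY (no definition, no named fact, no instance, no notation, no `sorry`). Sequel of
`ContinuousShapiroLiftCores.lean` (`shapiroLift`, `sum_shapiroCocycle_apply`: the fibre sum of the Shapiro lift is the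
transfer) and `ContinuousShapiroLiftPairing.lean` (the summed pairing `P.coindFin N`, the projection formula
`cupProduct_coindFinSum_left` BETWEEN TWO SUBGROUPS `N' ≤ N`).

Let `G` be a topological group, `N ≤ G` an open subgroup of finite index with representatives `s` (`s(1·N) = 1`),
`P : X × Y → Z` a continuous equivariant pairing of topological representations, `a ∈ H¹(N, X)`, `b ∈ H¹(G, Y)`. The tree's
corestriction `cores : H¹(N, X) → H¹(G, X)` exists only in degree one (`ContinuousCorestriction.lean`), so the classical
projection formula `cor(a ∪ res b) = cor(a) ∪ b` (Neukirch–Schmidt–Wingberg (1.5.3)(iv)) has no literal form in the tree;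
its Shapiro form is: the summed cup product `Sh_N(a) ∪_{ΣP} Sh_N(res b) ∈ H²(G, Z)` of the Shapiro lifts — which IS
`cor(a ∪ res b)` read through `H²(N, Z) ≅ H²(G, Maps(G ⧸ N, Z)) → H²(G, Z)` — equals the honest cup product `cor(a) ∪_P b`:

* `shapiroCocycle_pullback_subtype_apply` — on cocycles, the Shapiro lift of the restriction `g|_N` of a crossed
  homomorphism `g` of `G` is the diagonal `(τ ↦ (z ↦ g τ))` plus the coboundary of `β = (z ↦ g(s z))`:
  `Sh_N(g|_N)(τ)(z) = g(τ) + (τ • g(s(τ⁻¹ z)) − g(s z))`;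
* `twoCocycleClass_cupCocycle_shapiroCocycle_pullback` — on cocycles,
  `[Sh_N f ∪_{ΣP} Sh_N(g|_N)] = [cor_s f ∪_P g]` in `H²(G, Z)` (the diagonal part pairs to
  `⟨Σ_y Sh f(σ)(y), σ g τ⟩ = ⟨(cor_s f)(σ), σ g τ⟩` by `sum_shapiroCocycle_apply`; the coboundary part pairs to `0`);
* **`cupProduct_cores_eq_cupProduct_shapiroLift`** — on classes:
  `P.cupProduct (cores X N hN a) b = (P.coindFin N).cupProduct (Sh_N a) (Sh_N (resSubgroup Y N 1 b))`.

Consumer: the TWISTED plus/minus local duality at `2` (route `ResidualThetaTransportAtTwo` of `Summits/BirchSwinnertonDyer`,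
B. D. Kim 2007 Prop. 3.15/4.11): the local Tate pairing `⟨cor x, y⟩_{ℚ_v}` of a class corestricted from the layer
`U_m = Gal(ℚ̄_v/ℚ_{v,m})` is the layer pairing `⟨x, res y⟩_m` of the Shapiro model (`…SignedKatoUpToAtTwoLayerPairingModDefs`).

## References
* J. Neukirch, A. Schmidt, K. Wingberg, *Cohomology of Number Fields*, 2nd ed. (2008), I §5 Prop. (1.5.3)(iv) (projection
  formula), I §6 Prop. (1.6.4) (Shapiro). [NeukirchSchmidtWingberg2008]
* J.-P. Serre, *Local Fields* (1979), VII §6–§7 (induced modules, corestriction). [SerreLocalFields1979]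
* B. D. Kim, *The parity conjecture for elliptic curves at supersingular reduction primes*, Compositio Math. 143 (2007),
  proof of Prop. 3.15 (`⟨Cor x, y⟩_n = ⟨x, Res y⟩_m`). [BDKim2007]
-/

noncomputable section

open CategoryTheory

open scoped Classical

universe u v

namespace Literature.NumberTheory.GaloisRepresentations

open _root_.TopRep
open Literature.NumberTheory.EllipticCurves (schreierElt schreierElt_coe)

variable {R : Type u} [CommRing R] [TopologicalSpace R]
variable {G : Type v} [Group G] [TopologicalSpace G] [IsTopologicalGroup G]

section Cocycles

variable {X Y Z : TopRep.{v} R G} (P : ContPairing X Y Z) (N : Subgroup G) (hN : IsOpen (N : Set G))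
  {s : G ⧸ N → G} (hs : ∀ x : G ⧸ N, (s x : G ⧸ N) = x)

/-- **The Shapiro lift of a restricted cocycle, pointwise**: for a crossed homomorphism `g : G → Y` and its restriction
`g|_N` (pull-back along `N ↪ G`), `Sh_N(g|_N)(τ)(z) = g(τ) + (τ • g(s(τ⁻¹ • z)) − g(s z))` — the diagonal cocycle plus the
coboundary of `z ↦ g(s z)`. [cite: NeukirchSchmidtWingberg2008, I §6 Prop. (1.6.4)] -/
theorem shapiroCocycle_pullback_subtype_apply (g : contOneCocycles Y) (τ : G) (z : G ⧸ N) :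
    (shapiroCocycle Y N hN hs (contOneCocycles.pullback (subgroupSubtypeHom N) (Y := subgroupRep Y N)
        (TopRep.ofHom ⟨ContinuousLinearMap.id R Y, fun _ => rfl⟩) g)).1 τ z =
      g.1 τ + (Y.ρ τ (g.1 (s (τ⁻¹ • z))) - g.1 (s z)) := by
  rw [shapiroCocycle_apply, resSubgroup_pullback_apply, schreierElt_coe, smul_inv_smul, mul_assoc,
    contOneCocycles.apply_smul_inv_mul, g.2 τ]
  abel

variable [Fintype (G ⧸ N)] [LocallyCompactSpace G]

omit [TopologicalSpace G] [IsTopologicalGroup G] [Fintype (G ⧸ N)] [LocallyCompactSpace G] in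
/-- Summing the first slot of a pairing: `Σ_y P(φ y, w) = P(Σ_y φ y, w)`. [folklore] -/
private theorem sum_toLin_apply_left {ι : Type*} (S : Finset ι) (φ : ι → X) (w : Y) :
    ∑ y ∈ S, P.toLin (φ y) w = P.toLin (∑ y ∈ S, φ y) w := by
  rw [map_sum, LinearMap.sum_apply]

/-- **`[Sh_N f ∪_{ΣP} Sh_N(g|_N)] = [cor_s f ∪_P g]` on cocycles.** Write `Sh_N(g|_N) = Δ + ∂β` with the diagonal cocycle
`Δ(τ) = (z ↦ g τ)` of `Maps(G ⧸ N, Y)` and `β = (z ↦ g(s z))` (`shapiroCocycle_pullback_subtype_apply`); then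
`(Sh f ∪_{ΣP} Δ)(σ, τ) = Σ_y P(Sh f(σ)(y), g(στ) − g σ) = P((cor_s f)(σ), g(στ) − g σ) = (cor_s f ∪_P g)(σ, τ)` on the nose
(`sum_shapiroCocycle_apply`: the fibre sum of the Shapiro lift is the transfer), and `Sh f ∪ ∂β` is a coboundary
(`cupClass_eq_zero_of_right`). [cite: NeukirchSchmidtWingberg2008, I §5 Prop. (1.5.3)(iv)] [cite: NeukirchSchmidtWingberg2008, I §6 Prop. (1.6.4)] -/
theorem cupClass_shapiroCocycle_pullback_eq (f : contOneCocycles (subgroupRep X N)) (g : contOneCocycles Y) :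
    (P.coindFin N).cupClass (shapiroCocycle X N hN hs f)
        (shapiroCocycle Y N hN hs (contOneCocycles.pullback (subgroupSubtypeHom N) (Y := subgroupRep Y N)
          (TopRep.ofHom ⟨ContinuousLinearMap.id R Y, fun _ => rfl⟩) g)) =
      P.cupClass (transferCocycle X N hN hs f) g := by
  -- the diagonal cocycle `Δ(τ) = (z ↦ g τ)`
  let Δ : contOneCocycles (coindFin Y N) :=
    ⟨⟨fun τ => fun _ => g.1 τ, continuous_pi fun _ => g.1.continuous⟩, fun τ₁ τ₂ => by
      funext z
      change g.1 (τ₁ * τ₂) = g.1 τ₁ + Y.ρ τ₁ (g.1 τ₂)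
      exact g.2 τ₁ τ₂⟩
  have hΔ : ∀ τ z, Δ.1 τ z = g.1 τ := fun _ _ => rfl
  set Shg := shapiroCocycle Y N hN hs (contOneCocycles.pullback (subgroupSubtypeHom N) (Y := subgroupRep Y N)
    (TopRep.ofHom ⟨ContinuousLinearMap.id R Y, fun _ => rfl⟩) g) with hShg
  -- `Sh(g|_N) - Δ = ∂β`, `β z = g (s z)`
  have hcob : oneCocycleClass (coindFin Y N) (Shg - Δ) = 0 := by
    rw [oneCocycleClass_eq_zero_iff]
    refine ⟨fun z => g.1 (s z), fun τ => ?_⟩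
    funext z
    rw [Submodule.coe_sub, ContinuousMap.sub_apply]
    change Shg.1 τ z - Δ.1 τ z = Y.ρ τ (g.1 (s (τ⁻¹ • z))) - g.1 (s z)
    rw [hShg, shapiroCocycle_pullback_subtype_apply, hΔ]
    abel
  have hsplit : Shg = Δ + (Shg - Δ) := (add_sub_cancel Δ Shg).symm
  rw [hsplit, ContPairing.cupClass_add_right, (P.coindFin N).cupClass_eq_zero_of_right _ _ hcob, add_zero,
    ContPairing.cupClass_eq_twoCocycleClass, ContPairing.cupClass_eq_twoCocycleClass]
  congr 1
  refine Subtype.ext (ContinuousMap.ext fun p => ?_)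
  obtain ⟨σ, τ⟩ := p
  rw [ContPairing.cupCocycle_apply, ContPairing.cupCocycle_apply, ContPairing.coindFin_toLin_apply,
    transferCocycle_apply, ← sum_shapiroCocycle_apply X N hN hs f σ, ← sum_toLin_apply_left P]
  refine Finset.sum_congr rfl fun y _ => ?_
  rw [coindFin_sub_apply, hΔ, hΔ]

/-- The same identity for the classes of the inhomogeneous `2`-cocycles. [cite: NeukirchSchmidtWingberg2008, I §5 Prop. (1.5.3)(iv)] -/
theorem twoCocycleClass_cupCocycle_shapiroCocycle_pullback (f : contOneCocycles (subgroupRep X N))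
    (g : contOneCocycles Y) :
    twoCocycleClass Z ((P.coindFin N).cupCocycle (shapiroCocycle X N hN hs f)
        (shapiroCocycle Y N hN hs (contOneCocycles.pullback (subgroupSubtypeHom N) (Y := subgroupRep Y N)
          (TopRep.ofHom ⟨ContinuousLinearMap.id R Y, fun _ => rfl⟩) g))) =
      twoCocycleClass Z (P.cupCocycle (transferCocycle X N hN hs f) g) := by
  rw [← ContPairing.cupClass_eq_twoCocycleClass, ← ContPairing.cupClass_eq_twoCocycleClass,
    cupClass_shapiroCocycle_pullback_eq]

end Cocycles

section Classes

variable {X Y Z : TopRep.{v} R G} (P : ContPairing X Y Z) (N : Subgroup G) [Fintype (G ⧸ N)] [LocallyCompactSpace G]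
  (hN : IsOpen (N : Set G)) {s : G ⧸ N → G} (hs : ∀ x : G ⧸ N, (s x : G ⧸ N) = x) (hs1 : s ((1 : G) : G ⧸ N) = 1)

/-- **The projection formula at the top, in the Shapiro model**: for `a ∈ H¹(N, X)`, `b ∈ H¹(G, Y)` and a continuous
equivariant pairing `P : X × Y → Z`,
`cor(a) ∪_P b = Sh_N(a) ∪_{ΣP} Sh_N(res b)` in `H²(G, Z)` — the honest cup product of the corestriction against `b` is
the summed cup product of the Shapiro lifts of `a` and of the restriction of `b` (classically `cor(a ∪ res b) = cor a ∪ b`,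
NSW (1.5.3)(iv)). [cite: NeukirchSchmidtWingberg2008, I §5 Prop. (1.5.3)(iv)] [cite: NeukirchSchmidtWingberg2008, I §6 Prop. (1.6.4)]
[cite: BDKim2007, Prop. 3.15 (proof)] -/
theorem cupProduct_cores_eq_cupProduct_shapiroLift (a : continuousCohomology 1 (subgroupRep X N))
    (b : continuousCohomology 1 Y) :
    P.cupProduct (cores X N hN a) b =
      (P.coindFin N).cupProduct (shapiroLift X N hN hs hs1 a) (shapiroLift Y N hN hs hs1 (resSubgroup Y N 1 b)) := by
  obtain ⟨f, rfl⟩ := oneCocycleClass_surjective _ a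
  obtain ⟨g, rfl⟩ := oneCocycleClass_surjective _ b
  rw [cores_oneCocycleClass X N hN hs, resSubgroup_oneCocycleClass, shapiroLift_oneCocycleClass,
    shapiroLift_oneCocycleClass, ContPairing.cupProduct_oneCocycleClass, ContPairing.cupProduct_oneCocycleClass,
    cupClass_shapiroCocycle_pullback_eq]

/-- **Vanishing form** (the shape consumed by isotropy arguments): if the Shapiro classes pair to zero under the summed
pairing, then `cor(a) ∪_P b = 0`. [cite: NeukirchSchmidtWingberg2008, I §5 Prop. (1.5.3)(iv)] -/
theorem cupProduct_cores_eq_zero_of_shapiroLift (a : continuousCohomology 1 (subgroupRep X N))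
    (b : continuousCohomology 1 Y)
    (h : (P.coindFin N).cupProduct (shapiroLift X N hN hs hs1 a) (shapiroLift Y N hN hs hs1 (resSubgroup Y N 1 b)) = 0) :
    P.cupProduct (cores X N hN a) b = 0 := by
  rw [cupProduct_cores_eq_cupProduct_shapiroLift P N hN hs hs1, h]

end Classes

end Literature.NumberTheory.GaloisRepresentations

end
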